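import Mathlib
import Summits.ValiantsHypothesis.ValiantsHypothesis.Theorems.FreeSubtorusSubtorusCovering
import Summits.ValiantsHypothesis.ValiantsHypothesis.Cruxes.OrbitDimensionBound.Lines.ConfusionLadder

/-!
# `special` — F3 / BC5 witness for the rung `ConfusionCovering` (sorry-free)

Rung family: `Summit.ValiantsHypothesis.ValiantsHypothesis.Cruxes.OrbitDimensionBound.Confusion.CoveringRung ℓ`
(`Lines/ConfusionLadder.lean`).  The rung `ConfusionCovering = CoveringRung confusionLoss` SPECIALISES at the floor
parameter `ℓ = powLoss` (`powLoss n r Λ = 2 ^ r`) to the PROVED floor, seed g1-ValiantsHypothesis-16134 =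
`Summit.ValiantsHypothesis.ValiantsHypothesis.Theorems.FreeSubtorusSubtorusCovering.subtorusCovering_proof :
Theses.FreeSubtorus.SubtorusCovering` (`C(n,⌊n/2⌋) ≤ m · 2^r`).  Witness regime: admissibly cut subtori of
positive codimension `r ≥ 1` with exact lifts — the summit `VP_ℂ ≠ VNP_ℂ` is not known in ANY regime, and this
unconditional equivariant lower bound is not a case of it (S known there: no); the rung's lever (position of `Λ`,
not its rank) is exercised exactly where the floor is vacuous (rank `Λ ≥ n - 2`).
-/

set_option linter.dupNamespace false

namespace Summit.ValiantsHypothesis.ValiantsHypothesis.Cruxes.OrbitDimensionBound.Confusion.Special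

open Summit.ValiantsHypothesis.ValiantsHypothesis.Cruxes.OrbitDimensionBound.Confusion

/-- F3, literally: the rung family at the floor parameter `ℓ = 2^r`, from the seed theorem BY NAME
(`simpa` unfolding both the family and the floor's statement). -/
example : CoveringRung (fun _ r _ => 2 ^ r) := by
  simpa only [CoveringRung, Summit.ValiantsHypothesis.ValiantsHypothesis.Theses.FreeSubtorus.SubtorusCovering] using
    Summit.ValiantsHypothesis.ValiantsHypothesis.Theorems.FreeSubtorusSubtorusCovering.subtorusCovering_proof

/-- The same as a term: the family at the floor parameter is the floor, definitionally. -/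
example : CoveringRung (fun _ r _ => 2 ^ r) := fun n hn m r Λ B hΛ hB =>
  Summit.ValiantsHypothesis.ValiantsHypothesis.Theorems.FreeSubtorusSubtorusCovering.subtorusCovering_proof
    n hn m r Λ B hΛ hB

/-- The same with the named loss `powLoss`. -/
example : CoveringRung powLoss := by
  simpa only [CoveringRung, powLoss, Summit.ValiantsHypothesis.ValiantsHypothesis.Theses.FreeSubtorus.SubtorusCovering]
    using Summit.ValiantsHypothesis.ValiantsHypothesis.Theorems.FreeSubtorusSubtorusCovering.subtorusCovering_proof

/-- Named form (definitional: `CoveringRung powLoss` IS `SubtorusCovering`). [cite: LandsbergRessayre2017, Thm. 2.8] -/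
theorem rung_at_floor : CoveringRung powLoss :=
  Summit.ValiantsHypothesis.ValiantsHypothesis.Theorems.FreeSubtorusSubtorusCovering.subtorusCovering_proof

/-- The floor member of the family is literally the route's crux statement. [folklore] -/
theorem rung_at_floor_iff :
    CoveringRung powLoss ↔ Summit.ValiantsHypothesis.ValiantsHypothesis.Theses.FreeSubtorus.SubtorusCovering :=
  Iff.rfl

end Summit.ValiantsHypothesis.ValiantsHypothesis.Cruxes.OrbitDimensionBound.Confusion.Special
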